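/-
Copyright: the b2b-balaban T⁴-continuum CRUX team, row NE7b OWNER lineage `t4-ne7b-p1` (gen 124). Project licence.
-/
import Summits.QuantumFields.BalabanUV.T4Continuum.Spine.NE7b.SupZdCoarseTorusSeam

/-!
# [B4] (5.6) FOR BOTH COARSE OPERATORS ON THE TORUS AND (5.9) FOR THEIR DIFFERENCE, UNIFORMLY: on the coarse torus `Site d (3^k)` with
# its `ℓ¹` distance `ρ_k`, the torus Schur complement `T_k` (block columns of `H[V∘wm_k]`) and the window reading `T_∞∘wm` of the
# infinite-volume coarse operator (block columns of `H_V` on `ℤ^d`) are BOTH symmetric, have [B6]'s floor `γ = 1∕(36^d(4d + a + Λ))` and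
# entries `≤ c₀e^{−δ₀ρ_k}`, and their difference satisfies `|(T_∞∘wm − T_k)(y,y′)| ≤ c₀e^{−δ₀(ρ_k(y,y′) + ω y + ω y′)}` for the seam depth
# `ω(y) = max(0, 3^k∕2 − 2 − ρ_k(y,0))` (nonnegative, `ρ_k`-Lipschitz) — `(γ, c₀, δ₀)` from `(d, a, λ, Λ)` ONLY, every mesh, every level:
# exactly the hypotheses of [B4] (5.10) (`B4Sect5Torus.Sect5Uniform`, clause 3) (row NE7b, node U5c; (134)∕(135)∕(194)∕(197) BY NAME; [folklore])

Cell `pub-balaban`, sub-cell `t4`, spine estimate NE7b (`T4WeightBudget.RelWeightBound`; the cell's OWN estimate — NOT PRINTED in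
[Bałaban 1983–89], NOT PROVED).  Crux-route work under `Spine/NE7b/` by the row OWNER (`t4-ne7b-p1` gen 124, file (198)) under FREEZE
(0)'s crux-prover clause; NOTHING of Bałaban's is named as a Lean object, valued or asserted; no `T4Continuum/Support` leaf typed; no `def`,
no notation (both kernels DISPLAYED as `Matrix.of`; `ψ`, `Ψ` ANY block columns with their displayed equations); zero `sorry`.  Imports (BY
NAME): the OWNER's (197) `…SupZdCoarseTorusSeam` (`coarse_seam_row`), and through it (194) `zd_coarse_symmetric'`, `zd_coarse_section_hyp56`,
(182) `torusDist_le_l1`, (135) `coarse_floor`, (134) `schur_symm`, `schur_entry_le`, (132) `isPseudoDist_torus`, (131) `exists_rate`, the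
Literature engine `B4Sect5Torus` (`Hyp56`, `Hyp59`, `hyp56_submatrix`), the window kit (`windowMap_injective`, `siteOf_windowMap`),
Mathlib's `pow_le_pow_iff_left₀`.

WHY (located).  [B4] (5.10) compares the inverses of `A` and `A + B` on one finite index set when both satisfy (5.6) with the same
constants and `B` satisfies (5.9) with a Lipschitz boundary weight `ω`.  Here `A = T_k`, `A + B = T_∞∘wm`: (5.6) for `T_k` is (134)∕(135)
((136)'s proof, constants `γ`, `m_κ⁻¹e^{2dκ}`, `κ` of (131) `exists_rate`); (5.6) for `T_∞∘wm` is (194)'s `Hyp56` of the window SECTION of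
`T_∞` pulled back along the bijection `wm : Site d (3^k) → window` (`hyp56_submatrix`; the entry bound in `|wm y − wm y′|₁` dominates the
one in `ρ_k ≤ |wm y − wm y′|₁`); (5.9): `|B| ≤ |T_∞∘wm| + |T_k| ≤ c₀e^{−δ′ρ_k}`, `|B| ≤ c₀e^{−δ′ω(y)}` ((197) `coarse_seam_row`) and, both
kernels being symmetric, `|B| ≤ c₀e^{−δ′ω(y′)}`; the geometric mean of the three is `c₀e^{−(δ′∕3)(ρ_k + ω y + ω y′)}`; `ω` is Lipschitz by
the triangle inequality of `ρ_k` ((132)) since `ρ_k(y,0) = Σ_i|valMinAbs(y i)|`.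

WHAT IS PROVED ([folklore]): §1 `decay_weaken`, `abs_le_of_three` (three exponential bounds ⟹ their geometric mean); §2
**`coarse_torus_hyp`** (THE END: `∃ γ c₀ δ₀ > 0`, `γ = 1∕(36^d(4d + a + Λ))`: for ALL `n, V, Ψ, k, ψ`: `Hyp56 ρ_k T_k γ c₀ δ₀`,
`Hyp56 ρ_k (T_∞∘wm) γ c₀ δ₀`, `ω ≥ 0`, `ω x ≤ ρ_k(x,y) + ω y`, `Hyp59 ρ_k ω (T_∞∘wm − T_k) c₀ δ₀`).

HONEST (what this is NOT).  Hypotheses packaged — the application of [B4] (5.10) and the limit `T_k⁻¹(σ_k b, σ_k b′) → M(b,b′)` are the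
sequel; `d ≥ 3` only; the LINEAR column only; scalar skeleton ((A3), NC-NE7b-α UNRULED); nothing of the covariant propagators of
[B4]–[B6]; [B4] Sect. 5 is the tree's PROVED theorem — nothing of Bałaban's asserted.  BY-NAME EFFECT ON THE WALL: NONE.  NE7b NOT PRINTED ∕
NOT PROVED; spine PROVED 0∕9; rung (B)+1 — the programme's measures remain FINITE-torus statements; NOT the mass gap, NOT Clay.  HONEST
DEPENDENCY: continuum YM on T⁴ ⇐ BetaPertH ∧ nine spine estimates (0∕9 proved); BetaPertH ⇐ (D1) ∧ (D4) ∧ CAP+tail; G-an2-4 gates asym,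
D1 and NE2∕3∕4.
-/

set_option autoImplicit false

noncomputable section

namespace Summit.QuantumFields.BalabanUV.T4Continuum.NE7b.SupZdCoarseTorusHyp

open Real Filter Topology
open Literature.MathematicalPhysics.QuantumFieldTheory.Balaban1983to89
open B6QGQLower276 (X e blk B side chart mem_B sum_B sum_B_const card_cube blk_chart)
open Beta (Site siteOf windowMap siteOf_windowMap windowMap_siteOf windowMap_injective)
open B4Sect5Torus (IsPseudoDist Hyp56 Hyp59 hyp56_submatrix)
open SupTorusBlockDistance (isPseudoDist_torus)
open SupTorusSchurComplement (schur_symm schur_entry_le)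
open SupTorusCoarseFloor (coarse_floor)
open SupZdPropagatorProfile (torusDist_le_l1)
open SupZdCoarseInverse (zd_coarse_symmetric' zd_coarse_section_hyp56)
open SupZdCoarseTorusSeam (coarse_seam_row)

variable {d : ℕ}

/-! ## §1. Exponential bookkeeping -/

/-- Weakening a decay bound: `C ≤ c₀`, `δ_t ≤ δ`, `t ≥ 0` ⟹ `C·e^{−δt} ≤ c₀·e^{−δ_t t}`. [folklore] -/
theorem decay_weaken {C c₀ δ δt t : ℝ} (hC0 : 0 ≤ C) (hC : C ≤ c₀) (hδ : δt ≤ δ) (ht : 0 ≤ t) :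
    C * exp (-(δ * t)) ≤ c₀ * exp (-(δt * t)) :=
  mul_le_mul hC (exp_le_exp.2 (by nlinarith)) (exp_pos _).le (hC0.trans hC)

/-- **THREE BOUNDS MAKE ONE**: `|x| ≤ c e^{−δr}`, `|x| ≤ c e^{−δs}`, `|x| ≤ c e^{−δt}` ⟹ `|x| ≤ c e^{−(δ∕3)(r + s + t)}` (geometric mean). [folklore] -/
theorem abs_le_of_three {x c δ r s t : ℝ} (hc : 0 ≤ c) (h1 : |x| ≤ c * exp (-(δ * r))) (h2 : |x| ≤ c * exp (-(δ * s)))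
    (h3 : |x| ≤ c * exp (-(δ * t))) : |x| ≤ c * exp (-(δ / 3 * (r + s + t))) := by
  have hy : 0 ≤ c * exp (-(δ / 3 * (r + s + t))) := by positivity
  refine (pow_le_pow_iff_left₀ (abs_nonneg x) hy three_ne_zero).1 ?_
  have e1 : exp (-(δ * r)) * exp (-(δ * s)) * exp (-(δ * t)) = exp (-(δ / 3 * (r + s + t))) ^ 3 := by
    rw [← Real.exp_nat_mul, ← exp_add, ← exp_add]
    congr 1; push_cast; ring
  calc |x| ^ 3 = |x| * |x| * |x| := by ring
    _ ≤ c * exp (-(δ * r)) * (c * exp (-(δ * s))) * (c * exp (-(δ * t))) :=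
        mul_le_mul (mul_le_mul h1 h2 (abs_nonneg _) ((abs_nonneg _).trans h1)) h3 (abs_nonneg _) (by positivity)
    _ = (c * exp (-(δ / 3 * (r + s + t)))) ^ 3 := by rw [mul_pow, ← e1]; ring

/-! ## §2. THE END: [B4] (5.6) for both coarse operators on the torus `Site d (3^k)`, and (5.9) for their difference with the seam depth -/

/-- **HEADLINE — THE HYPOTHESES OF [B4] (5.10) ON THE COARSE TORUS, UNIFORMLY**: `d ≥ 3`, `a > 0`, `λ < min(2,a)`, `Λ ≥ 0` ⟹
`∃ γ c₀ δ₀ > 0` (from `(d, a, λ, Λ)` ONLY) such that for ALL `n`, `V : ℤ^d → [−λ, Λ]`, ANY bounded `ℤ^d` block columns `Ψ` of `H_V`, every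
level `k` and ANY torus block columns `ψ` of `H[V∘wm_k]`: with `ρ_k` the `ℓ¹` torus distance and `ω(y) = max(0, 3^k∕2 − 2 − ρ_k(y,0))`,
(i) the torus Schur complement `T_k` satisfies `Hyp56 ρ_k T_k γ c₀ δ₀` ((134) symmetry, (135) floor, (134) entries); (ii) the window
reading `T_∞∘wm` of the infinite-volume coarse operator satisfies `Hyp56 ρ_k (T_∞∘wm) γ c₀ δ₀` ((194) on the window section, pulled back
along `wm`, `ρ_k ≤ |wm · − wm ·|₁`); (iii) `ω ≥ 0` and `ω` is `ρ_k`-Lipschitz; (iv) `Hyp59 ρ_k ω (T_∞∘wm − T_k) c₀ δ₀` — the three bounds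
«both entries decay», «seam row» ((197)) and «seam column» (symmetry) combined by the geometric mean. [folklore] -/
theorem coarse_torus_hyp (hd : 3 ≤ d) (a : ℝ) (ha : 0 < a) {lam Lam : ℝ} (hlam : lam < min 2 a) (hLam : 0 ≤ Lam) :
    ∃ γ c₀ δ₀ : ℝ, 0 < γ ∧ 0 < c₀ ∧ 0 < δ₀ ∧ ∀ (n : ℕ) (V : X d → ℝ), (∀ p, -lam ≤ V p) → (∀ p, V p ≤ Lam) →
      ∀ (Ψ : X d → X d → ℝ) (BΨ : X d → ℝ), (∀ b' p, |Ψ b' p| ≤ BΨ b') →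
      (∀ b' p, ((n : ℝ) + 1) ^ 2 * ∑ μ, (2 * Ψ b' p - Ψ b' (p + e μ) - Ψ b' (p - e μ))
        + a / ((n : ℝ) + 1) ^ d * ∑ q ∈ B n (blk n p), Ψ b' q + V p * Ψ b' p = if blk n p = b' then 1 else 0) →
      ∀ (k : ℕ) (ψ : Site d (3 ^ k) → Site d ((n + 1) * 3 ^ k) → ℝ),
      (∀ (y' : Site d (3 ^ k)) (x : Site d ((n + 1) * 3 ^ k)),
        ((n : ℝ) + 1) ^ 2 * ∑ μ, (2 * ψ y' x - ψ y' (x + siteOf d ((n + 1) * 3 ^ k) (e μ)) - ψ y' (x - siteOf d ((n + 1) * 3 ^ k) (e μ)))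
          + a / ((n : ℝ) + 1) ^ d * ∑ q ∈ B n (blk n (windowMap d ((n + 1) * 3 ^ k) x)), ψ y' (siteOf d ((n + 1) * 3 ^ k) q)
          + V (windowMap d ((n + 1) * 3 ^ k) x) * ψ y' x
          = if siteOf d (3 ^ k) (blk n (windowMap d ((n + 1) * 3 ^ k) x)) = y' then 1 else 0) →
      Hyp56 (fun x y : Site d (3 ^ k) => ∑ i, (((x i - y i).valMinAbs.natAbs : ℕ) : ℝ))
        (Matrix.of fun y y' : Site d (3 ^ k) =>
          (((n : ℝ) + 1) ^ d)⁻¹ * ∑ z : Fin d → Fin (n + 1), ψ y' (siteOf d ((n + 1) * 3 ^ k) (chart n (windowMap d (3 ^ k) y) z)))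
        (1 / ((36 : ℝ) ^ d * (4 * d + a + Lam))) c₀ δ₀ ∧
      Hyp56 (fun x y : Site d (3 ^ k) => ∑ i, (((x i - y i).valMinAbs.natAbs : ℕ) : ℝ))
        (Matrix.of fun y y' : Site d (3 ^ k) => (((n : ℝ) + 1) ^ d)⁻¹ * ∑ q ∈ B n (windowMap d (3 ^ k) y), Ψ (windowMap d (3 ^ k) y') q)
        (1 / ((36 : ℝ) ^ d * (4 * d + a + Lam))) c₀ δ₀ ∧
      (∀ y : Site d (3 ^ k), 0 ≤ max 0 (((3 ^ k : ℕ) : ℝ) / 2 - 2 - ∑ i, ((((y i).valMinAbs).natAbs : ℕ) : ℝ))) ∧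
      (∀ x y : Site d (3 ^ k), max 0 (((3 ^ k : ℕ) : ℝ) / 2 - 2 - ∑ i, ((((x i).valMinAbs).natAbs : ℕ) : ℝ))
        ≤ ∑ i, (((x i - y i).valMinAbs.natAbs : ℕ) : ℝ) + max 0 (((3 ^ k : ℕ) : ℝ) / 2 - 2 - ∑ i, ((((y i).valMinAbs).natAbs : ℕ) : ℝ))) ∧
      Hyp59 (fun x y : Site d (3 ^ k) => ∑ i, (((x i - y i).valMinAbs.natAbs : ℕ) : ℝ))
        (fun y => max 0 (((3 ^ k : ℕ) : ℝ) / 2 - 2 - ∑ i, ((((y i).valMinAbs).natAbs : ℕ) : ℝ)))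
        ((Matrix.of fun y y' : Site d (3 ^ k) => (((n : ℝ) + 1) ^ d)⁻¹ * ∑ q ∈ B n (windowMap d (3 ^ k) y), Ψ (windowMap d (3 ^ k) y') q)
          - Matrix.of fun y y' : Site d (3 ^ k) =>
            (((n : ℝ) + 1) ^ d)⁻¹ * ∑ z : Fin d → Fin (n + 1), ψ y' (siteOf d ((n + 1) * 3 ^ k) (chart n (windowMap d (3 ^ k) y) z)))
        c₀ δ₀ ∧ γ = 1 / ((36 : ℝ) ^ d * (4 * d + a + Lam)) := by
  classical
  have hm0 : 0 < min 2 a - lam := by linarith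
  obtain ⟨κ, hκ0, hκ1, hκm⟩ := SupTorusHessianCombesThomas.exists_rate (d := d) a ha.le hm0
  have hm : 0 < min 2 a - lam - 2 * d * κ ^ 2 - a * (exp (2 * d * κ) - 1) := by linarith
  obtain ⟨CT, hCT⟩ : ∃ CT : ℝ, CT = (min 2 a - lam - 2 * d * κ ^ 2 - a * (exp (2 * d * κ) - 1))⁻¹ * exp (2 * d * κ) := ⟨_, rfl⟩
  have hCT0 : 0 < CT := by rw [hCT]; exact mul_pos (inv_pos.2 hm) (exp_pos _)
  obtain ⟨Ci, δi, hCi, hδi, H56⟩ := zd_coarse_section_hyp56 (d := d) hd a ha hlam hLam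
  obtain ⟨Cs, δs, hCs, hδs, Hrow⟩ := coarse_seam_row (d := d) hd a ha hlam hLam
  have hγ : (0 : ℝ) < 1 / ((36 : ℝ) ^ d * (4 * d + a + Lam)) := by positivity
  set c₀ : ℝ := CT + Ci + Cs with hc₀
  set δ' : ℝ := min (min κ δi) δs with hδ'
  have hδ'0 : 0 < δ' := lt_min (lt_min hκ0 hδi) hδs
  have hδ'κ : δ' ≤ κ := (min_le_left _ _).trans (min_le_left _ _)
  have hδ'i : δ' ≤ δi := (min_le_left _ _).trans (min_le_right _ _)
  have hδ's : δ' ≤ δs := min_le_right _ _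
  have hδ'3 : δ' / 3 ≤ δ' := by linarith
  refine ⟨1 / ((36 : ℝ) ^ d * (4 * d + a + Lam)), c₀, δ' / 3, hγ, by positivity, by positivity, ?_⟩
  intro n V hV hV' Ψ BΨ hΨB hΨ k ψ hψ
  -- the two kernels, abbreviated
  obtain ⟨Tk, hTk⟩ : ∃ Tk : Site d (3 ^ k) → Site d (3 ^ k) → ℝ, ∀ y y', Tk y y' = (((n : ℝ) + 1) ^ d)⁻¹
      * ∑ z : Fin d → Fin (n + 1), ψ y' (siteOf d ((n + 1) * 3 ^ k) (chart n (windowMap d (3 ^ k) y) z)) := ⟨_, fun _ _ => rfl⟩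
  obtain ⟨Ti, hTi⟩ : ∃ Ti : Site d (3 ^ k) → Site d (3 ^ k) → ℝ, ∀ y y', Ti y y' = (((n : ℝ) + 1) ^ d)⁻¹
      * ∑ q ∈ B n (windowMap d (3 ^ k) y), Ψ (windowMap d (3 ^ k) y') q := ⟨_, fun _ _ => rfl⟩
  have eTk : (Matrix.of fun y y' : Site d (3 ^ k) => (((n : ℝ) + 1) ^ d)⁻¹
      * ∑ z : Fin d → Fin (n + 1), ψ y' (siteOf d ((n + 1) * 3 ^ k) (chart n (windowMap d (3 ^ k) y) z))) = Matrix.of fun y y' => Tk y y' := by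
    ext y y'; simp only [Matrix.of_apply, hTk]
  have eTi : (Matrix.of fun y y' : Site d (3 ^ k) => (((n : ℝ) + 1) ^ d)⁻¹ * ∑ q ∈ B n (windowMap d (3 ^ k) y), Ψ (windowMap d (3 ^ k) y') q)
      = Matrix.of fun y y' => Ti y y' := by
    ext y y'; simp only [Matrix.of_apply, hTi]
  have hρ0 : ∀ x y : Site d (3 ^ k), (0 : ℝ) ≤ ∑ i, (((x i - y i).valMinAbs.natAbs : ℕ) : ℝ) := fun x y => by positivity
  -- the torus operator: symmetric, local, floor ((134), (135))
  have hTk_symm : ∀ y y', Tk y y' = Tk y' y := fun y y' => by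
    rw [hTk, hTk]; exact schur_symm n a (3 ^ k) (fun x => V (windowMap d ((n + 1) * 3 ^ k) x)) ψ hψ y y'
  have hTk_le : ∀ y y', |Tk y y'| ≤ CT * exp (-(κ * ∑ i, (((y i - y' i).valMinAbs.natAbs : ℕ) : ℝ))) := fun y y' => by
    rw [hTk, hCT]
    exact schur_entry_le n a (3 ^ k) ha.le hκ0.le hκ1 hm (fun x => V (windowMap d ((n + 1) * 3 ^ k) x)) (fun x => hV _) ψ hψ y y'
  have hTk_floor : ∀ g : Site d (3 ^ k) → ℝ, 1 / ((36 : ℝ) ^ d * (4 * d + a + Lam)) * ∑ y, g y ^ 2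
      ≤ ∑ y, g y * ∑ y', Tk y y' * g y' := fun g => by
    simp only [hTk]
    exact coarse_floor n a (3 ^ k) ha hlam.le hLam (fun x => V (windowMap d ((n + 1) * 3 ^ k) x)) (fun x => hV _) (fun x => hV' _) ψ hψ g
  -- the window reading of `T_∞`: symmetric, local in `ρ_k`, floor (pull-back of (194)'s section along `wm`)
  have hTi_symm : ∀ y y', Ti y y' = Ti y' y := fun y y' => by
    rw [hTi, hTi]; exact zd_coarse_symmetric' hd a ha hlam hLam n V hV hV' Ψ BΨ hΨB hΨ _ _
  set S : Finset (X d) := Finset.univ.image (windowMap d (3 ^ k)) with hS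
  have hmem : ∀ y : Site d (3 ^ k), windowMap d (3 ^ k) y ∈ S := fun y => Finset.mem_image_of_mem _ (Finset.mem_univ y)
  set ι : Site d (3 ^ k) → S := fun y => ⟨windowMap d (3 ^ k) y, hmem y⟩ with hι
  have hιinj : Function.Injective ι := fun y y' h => windowMap_injective d (3 ^ k) (by simpa [hι] using congrArg Subtype.val h)
  have h56S := hyp56_submatrix (H56 n V hV hV' Ψ BΨ hΨB hΨ S) hιinj
  have hsub : (Matrix.of fun b b' : S => (((n : ℝ) + 1) ^ d)⁻¹ * ∑ q ∈ B n (b : X d), Ψ (b' : X d) q).submatrix ι ι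
      = Matrix.of fun y y' => Ti y y' := by
    ext y y'; simp only [Matrix.submatrix_apply, Matrix.of_apply, hι, hTi]
  rw [hsub] at h56S
  have hTi_le : ∀ y y', |Ti y y'| ≤ Ci * exp (-(δi * ∑ i, (((y i - y' i).valMinAbs.natAbs : ℕ) : ℝ))) := fun y y' => by
    have h := h56S.2.2 y y'
    simp only [Matrix.of_apply, hι] at h
    refine h.trans (mul_le_mul_of_nonneg_left (exp_le_exp.2 (neg_le_neg (mul_le_mul_of_nonneg_left ?_ hδi.le))) hCi.le)
    have := torusDist_le_l1 (d := d) (3 ^ k) (windowMap d (3 ^ k) y) (windowMap d (3 ^ k) y')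
    simpa only [siteOf_windowMap] using this
  -- the seam, both ways
  have hseam : ∀ y y', |Ti y y' - Tk y y'| ≤ Cs * exp (-(δs * max 0 (((3 ^ k : ℕ) : ℝ) / 2 - 2 - ∑ i, ((((y i).valMinAbs).natAbs : ℕ) : ℝ)))) :=
    fun y y' => by rw [abs_sub_comm, hTi, hTk]; exact Hrow n V hV hV' Ψ BΨ hΨB hΨ k ψ hψ y y'
  have hseam' : ∀ y y', |Ti y y' - Tk y y'| ≤ Cs * exp (-(δs * max 0 (((3 ^ k : ℕ) : ℝ) / 2 - 2 - ∑ i, ((((y' i).valMinAbs).natAbs : ℕ) : ℝ)))) :=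
    fun y y' => by rw [hTi_symm, hTk_symm]; exact hseam y' y
  -- the depth is a `ρ_k`-Lipschitz nonnegative weight
  have hN : ∀ y : Site d (3 ^ k), ∑ i, (((y i - (0 : Site d (3 ^ k)) i).valMinAbs.natAbs : ℕ) : ℝ)
      = ∑ i, ((((y i).valMinAbs).natAbs : ℕ) : ℝ) := fun y => Finset.sum_congr rfl fun i _ => by simp
  have hlip : ∀ x y : Site d (3 ^ k), max 0 (((3 ^ k : ℕ) : ℝ) / 2 - 2 - ∑ i, ((((x i).valMinAbs).natAbs : ℕ) : ℝ))
      ≤ ∑ i, (((x i - y i).valMinAbs.natAbs : ℕ) : ℝ) + max 0 (((3 ^ k : ℕ) : ℝ) / 2 - 2 - ∑ i, ((((y i).valMinAbs).natAbs : ℕ) : ℝ)) := by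
    intro x y
    have htri := (isPseudoDist_torus (d := d) (3 ^ k)).triangle y x 0
    rw [hN y, hN x, (isPseudoDist_torus (d := d) (3 ^ k)).symm y x] at htri
    have e2 := le_max_right 0 (((3 ^ k : ℕ) : ℝ) / 2 - 2 - ∑ i, ((((y i).valMinAbs).natAbs : ℕ) : ℝ))
    exact max_le (add_nonneg (hρ0 x y) (le_max_left _ _)) (by linarith)
  rw [eTk, eTi]
  refine ⟨⟨Matrix.IsSymm.ext fun y y' => ?_, fun v => ?_, fun y y' => ?_⟩,
    ⟨Matrix.IsSymm.ext fun y y' => ?_, h56S.2.1, fun y y' => ?_⟩, fun y => le_max_left _ _, hlip, fun y y' => ?_, rfl⟩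
  · simp only [Matrix.of_apply]; exact hTk_symm y' y
  · simpa only [Matrix.mulVec, dotProduct, Matrix.of_apply] using hTk_floor v
  · simp only [Matrix.of_apply]
    exact decay_weaken hCT0.le (by rw [hc₀]; linarith) (hδ'3.trans hδ'κ) (hρ0 y y') |>.trans' (hTk_le y y')
  · simp only [Matrix.of_apply]; exact hTi_symm y' y
  · simp only [Matrix.of_apply]
    exact decay_weaken hCi.le (by rw [hc₀]; linarith) (hδ'3.trans hδ'i) (hρ0 y y') |>.trans' (hTi_le y y')
  · -- (5.9): three bounds and their geometric mean
    simp only [Matrix.sub_apply, Matrix.of_apply]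
    have hω0 : ∀ y : Site d (3 ^ k), 0 ≤ max 0 (((3 ^ k : ℕ) : ℝ) / 2 - 2 - ∑ i, ((((y i).valMinAbs).natAbs : ℕ) : ℝ)) :=
      fun y => le_max_left _ _
    have s1 : |Ti y y' - Tk y y'| ≤ c₀ * exp (-(δ' * ∑ i, (((y i - y' i).valMinAbs.natAbs : ℕ) : ℝ))) := by
      have e1 := decay_weaken hCi.le le_rfl hδ'i (hρ0 y y') |>.trans' (hTi_le y y')
      have e2 := decay_weaken hCT0.le le_rfl hδ'κ (hρ0 y y') |>.trans' (hTk_le y y')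
      have e3 : 0 ≤ Cs * exp (-(δ' * ∑ i, (((y i - y' i).valMinAbs.natAbs : ℕ) : ℝ))) := by positivity
      calc |Ti y y' - Tk y y'| ≤ |Ti y y'| + |Tk y y'| := abs_sub _ _
        _ ≤ Ci * exp (-(δ' * ∑ i, (((y i - y' i).valMinAbs.natAbs : ℕ) : ℝ)))
            + CT * exp (-(δ' * ∑ i, (((y i - y' i).valMinAbs.natAbs : ℕ) : ℝ))) := add_le_add e1 e2
        _ ≤ c₀ * exp (-(δ' * ∑ i, (((y i - y' i).valMinAbs.natAbs : ℕ) : ℝ))) := by rw [hc₀]; nlinarith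
    have hCsc : Cs ≤ c₀ := by rw [hc₀]; linarith
    have s2 := decay_weaken (c₀ := c₀) hCs.le hCsc hδ's (hω0 y) |>.trans' (hseam y y')
    have s3 := decay_weaken (c₀ := c₀) hCs.le hCsc hδ's (hω0 y') |>.trans' (hseam' y y')
    exact abs_le_of_three (by positivity) s1 s2 s3

end Summit.QuantumFields.BalabanUV.T4Continuum.NE7b.SupZdCoarseTorusHyp
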